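import Summits.CriticalPhenomena.PercolationContinuityZ3.Theorems.PercNearOneGluingNoHeavyLowerTailMajorityGluingTypeBridgeLaw
import Summits.CriticalPhenomena.PercolationContinuityZ3.Theorems.PercNearOneGluingNoHeavyLowerTailMajorityGluingIsoPtsMain
import Summits.CriticalPhenomena.PercolationContinuityZ3.Theorems.PercNearOneGluingNoHeavyLowerTailMajorityGluingTypeTableBottomRegimeA
import HarnessLib

/-!
# The TYPE BRIDGE, part VII: the isolation rows (ISO₃ / ISO₄ / ISO₅) of `SymLaw` hold for the law of the hub gadget (lane prim-rate, constants-miner 1, gen 31; CANDIDATES §GEN-16 R130, §GEN-31)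

Support file for the closed crux `NoHeavyLowerTail` (stmt-CriticalPhenomena-4575), majority-gluing line.  The power rows of
`HubOnly.TypeTable.SymLaw` — `u_S^{γ} ≤ M^{|S|−γ}·∏_{t∈S} ρ_t^S` for the marked sub-systems `S` of `{a, v 1, …, v 4}` with `γ = c₃, c₄, 5/2` —
hold for the scale-free law `law w a v M` of the hub gadget: the isolation mass `u_S(law) = μ(the points of S pairwise separated)/M` and the
supports `ρ_t^S(law) = μ(t joined to no other point of S)/M` (part III + `typeOf_sep`), so each row is the m-point isolation inequality
`IsoPts.iso_points` (kernel, this gen) divided by `M^γ` (`iso_list_law`).  Instances in the exact shape of the `SymLaw` fields: `isoH_law`,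
`isoR_law`, `iso4_law` (with `ρ_z^{1234} = S_z ⊔ T_z`), `isoH4_law`, `iso5_law`.  No sorries. [cite: VandenbergHaggstromKahn2005, Thm. 1.3 (p. 6)]
-/

noncomputable section

namespace Summit.CriticalPhenomena.PercolationContinuityZ3.Theorems

open MeasureTheory Set
open Literature.Probability.LatticeModels (prodBernoulli)
open Literature.Probability.Percolation

namespace HubOnly
namespace TypeTable

/-- Typewise identities behind the `SymLaw` shapes of the ISO rows: the support `π_{a¬b}` is `ρ_a^{0ab}`, and `ρ_z^{1234} = S_z ∨ T_z`
(disjointly). -/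
theorem iso_typewise : (∀ τ ∈ allTypes, ∀ a ∈ [1, 2, 3, 4], ∀ b ∈ [1, 2, 3, 4], a ≠ b → τ.piSupp a b = τ.rho [0, a, b] a) ∧
    (∀ τ ∈ allTypes, ∀ z ∈ [1, 2, 3, 4], τ.rho [1, 2, 3, 4] z = (τ.isS z || τ.isT z) ∧ (τ.isS z && τ.isT z) = false) := by
  refine ⟨by decide +kernel, by decide +kernel⟩

/-- `pwSep S` is pairwise separation along the list. -/
theorem pwSep_iff (τ : DType) : ∀ S : List ℕ, τ.pwSep S = true ↔ S.Pairwise fun s t => τ.sep s t = true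
  | [] => by simp [DType.pwSep]
  | s :: l => by
    rw [DType.pwSep, Bool.and_eq_true, List.all_eq_true, List.pairwise_cons, pwSep_iff τ l]

namespace Bridge

open Refresh
open scoped Classical

variable {n : ℕ}

/-- The marked points are injective on the indices `0..4` (hub `≠` relays, relays distinct). -/
theorem pt_inj (a : Fin n) (v : ℕ → Fin n) (hv : ∀ x ∈ [1, 2, 3, 4], v x ≠ a)
    (hinj : ∀ x ∈ [1, 2, 3, 4], ∀ y ∈ [1, 2, 3, 4], v x = v y → x = y) :
    ∀ s ∈ [0, 1, 2, 3, 4], ∀ t ∈ [0, 1, 2, 3, 4], pt a v s = pt a v t → s = t := by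
  intro s hs t ht h
  simp only [List.mem_cons, List.not_mem_nil, or_false] at hs ht
  rcases hs with rfl | rfl | rfl | rfl | rfl <;> rcases ht with rfl | rfl | rfl | rfl | rfl <;>
    first | rfl | exact absurd h (hv _ (by simp)) | exact absurd h.symm (hv _ (by simp)) |
      exact hinj _ (by simp) _ (by simp) h

/-- The sublists of `[0,1,2,3,4]` used by the rows lie in `[0,1,2,3,4]`. -/
theorem sep_typeOf (a : Fin n) (v : ℕ → Fin n) (hv : ∀ x ∈ [1, 2, 3, 4], v x ≠ a) (ω : BondConfig (Fin n))
    {s t : ℕ} (hs : s ∈ [0, 1, 2, 3, 4]) (ht : t ∈ [0, 1, 2, 3, 4]) :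
    (typeOf a v ω).sep s t = true ↔ ¬ (openGraph ω).Reachable (pt a v s) (pt a v t) := by
  rw [typeOf_sep a v hv ω s hs t ht, decide_eq_true_eq]

/-- **THE m-POINT ISOLATION ROW FOR A MARKED SUB-SYSTEM `S`** of the hub gadget (a nodup sub-list of the indices `0..4`, `0` = hub):
`u_S(law)^γ ≤ M^{|S|−γ}·∏_{k} ρ^S_{S[k]}(law)` for every admissible exponent `γ` (`K = |S| − 1`). [cite: VandenbergHaggstromKahn2005, Thm. 1.3 (p. 6)] -/
theorem iso_list_law (w : Sym2 (Fin n) → unitInterval) (a : Fin n) (v : ℕ → Fin n) (hv : ∀ x ∈ [1, 2, 3, 4], v x ≠ a)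
    (hinj : ∀ x ∈ [1, 2, 3, 4], ∀ y ∈ [1, 2, 3, 4], v x = v y → x = y) {M : ℝ} (hM : 0 < M)
    (S : List ℕ) (hS : ∀ s ∈ S, s ∈ [0, 1, 2, 3, 4]) (hSnd : S.Nodup) {K γ : ℝ} (hK : (S.length : ℝ) = K + 1)
    (hγK : K + 1 ≤ K * γ) (hγq : 0 ≤ K * γ ^ 2 - 3 * K * γ + K + 1) (hγ2 : 2 ≤ γ) :
    uS S (law w a v M) ^ γ ≤ M ^ ((S.length : ℝ) - γ) *
      ∏ k : Fin S.length, lin (fun τ => DType.ind (τ.rho S (S[(k : ℕ)]))) (law w a v M) := by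
  set μ := prodBernoulli w with hμ
  set t : Fin S.length → Fin n := fun k => pt a v (S[(k : ℕ)]) with htdef
  have hget : ∀ k : Fin S.length, S[(k : ℕ)] ∈ [0, 1, 2, 3, 4] := fun k => hS _ (List.getElem_mem k.2)
  have htinj : Function.Injective t := by
    intro k l h
    have := pt_inj a v hv hinj _ (hget k) _ (hget l) h
    exact Fin.ext ((List.Nodup.getElem_inj_iff hSnd).1 this)
  -- the isolation event
  have hU : {ω : BondConfig (Fin n) | (typeOf a v ω).uB S = true} =
      {ω | ∀ k l : Fin S.length, k ≠ l → ¬ (openGraph ω).Reachable (t k) (t l)} := by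
    ext ω
    simp only [mem_setOf_eq, DType.uB, pwSep_iff, List.pairwise_iff_getElem]
    constructor
    · intro h k l hkl
      rcases lt_or_gt_of_ne (fun h' : (k : ℕ) = l => hkl (Fin.ext h')) with hlt | hgt
      · have := h k l k.2 l.2 hlt
        rw [sep_typeOf a v hv ω (hget k) (hget l)] at this
        exact this
      · have := h l k l.2 k.2 hgt
        rw [sep_typeOf a v hv ω (hget l) (hget k)] at this
        exact fun h' => this h'.symm
    · intro h i j hi hj hij
      have := h ⟨i, hi⟩ ⟨j, hj⟩ (fun h' => absurd (Fin.ext_iff.1 h') (Nat.ne_of_lt hij))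
      rw [sep_typeOf a v hv ω (hget ⟨i, hi⟩) (hget ⟨j, hj⟩)]
      exact this
  -- the support events
  have hR : ∀ k : Fin S.length, {ω : BondConfig (Fin n) | (typeOf a v ω).rho S (S[(k : ℕ)]) = true} =
      {ω | ∀ l : Fin S.length, l ≠ k → ¬ (openGraph ω).Reachable (t k) (t l)} := by
    intro k; ext ω
    simp only [mem_setOf_eq, DType.rho, List.all_eq_true, Bool.or_eq_true, beq_iff_eq]
    constructor
    · intro h l hlk
      have hne : S[(l : ℕ)] ≠ S[(k : ℕ)] := fun h' => hlk (Fin.ext ((List.Nodup.getElem_inj_iff hSnd).1 h'))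
      rcases h _ (List.getElem_mem l.2) with h' | h'
      · exact absurd h' hne
      · rw [sep_typeOf a v hv ω (hget k) (hget l)] at h'; exact h'
    · intro h s' hs'
      obtain ⟨l, hl, rfl⟩ := List.mem_iff_getElem.1 hs'
      by_cases hlk : (⟨l, hl⟩ : Fin S.length) = k
      · left; rw [← hlk]
      · right; rw [sep_typeOf a v hv ω (hget k) (hget ⟨l, hl⟩)]; exact h ⟨l, hl⟩ hlk
  -- the m-point isolation inequality
  have hKcard : (Fintype.card (Fin S.length) : ℝ) = K + 1 := by rw [Fintype.card_fin]; exact hK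
  have hiso := IsoPts.iso_points hKcard hγK hγq hγ2 w t htinj
  rw [← hU] at hiso
  simp only [← hR] at hiso
  -- scale-free form
  have hu : uS S (law w a v M) = μ.real {ω : BondConfig (Fin n) | (typeOf a v ω).uB S = true} / M := by
    show lin (fun τ => DType.ind (τ.uB S)) (law w a v M) = _
    rw [lin_ind_law w a v hv]
  have hr : ∀ k : Fin S.length, lin (fun τ => DType.ind (τ.rho S (S[(k : ℕ)]))) (law w a v M) =
      μ.real {ω : BondConfig (Fin n) | (typeOf a v ω).rho S (S[(k : ℕ)]) = true} / M := fun k => lin_ind_law w a v hv M _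
  rw [hu, Finset.prod_congr rfl fun k _ => hr k, Finset.prod_div_distrib, Finset.prod_const, Finset.card_univ, Fintype.card_fin,
    Real.div_rpow measureReal_nonneg hM.le]
  have hMγ : 0 < M ^ γ := Real.rpow_pos_of_pos hM γ
  have hpow : M ^ ((S.length : ℝ) - γ) *
      ((∏ k : Fin S.length, μ.real {ω : BondConfig (Fin n) | (typeOf a v ω).rho S (S[(k : ℕ)]) = true}) / M ^ S.length) =
      (∏ k : Fin S.length, μ.real {ω : BondConfig (Fin n) | (typeOf a v ω).rho S (S[(k : ℕ)]) = true}) / M ^ γ := by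
    rw [Real.rpow_sub hM, Real.rpow_natCast]
    field_simp
  rw [hpow]
  exact div_le_div_of_nonneg_right hiso hMγ.le

/-! ### The five instances in the shape of the `SymLaw` fields -/

section Instances

variable (w : Sym2 (Fin n) → unitInterval) (a : Fin n) (v : ℕ → Fin n) (hv : ∀ x ∈ [1, 2, 3, 4], v x ≠ a)
  (hinj : ∀ x ∈ [1, 2, 3, 4], ∀ y ∈ [1, 2, 3, 4], v x = v y → x = y) {M : ℝ} (hM : 0 < M)
include hv hinj hM

/-- **Hub ISO₃ rows** `u_{0ab}^{c₃} ≤ M^{3−c₃}·ρ₀·π_{a¬b}·π_{b¬a}`. [cite: VandenbergHaggstromKahn2005, Thm. 1.3 (p. 6)] -/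
theorem isoH_law : ∀ z₁ ∈ [1, 2, 3, 4], ∀ z₂ ∈ [1, 2, 3, 4], z₁ ≠ z₂ →
    uS [0, z₁, z₂] (law w a v M) ^ ((3 + Real.sqrt 3) / 2) ≤
      M ^ (3 - (3 + Real.sqrt 3) / 2) * Rho0 z₁ z₂ (law w a v M) * Pim z₁ z₂ (law w a v M) * Pim z₂ z₁ (law w a v M) := by
  intro z₁ h1 z₂ h2 h12
  have h10 : z₁ ≠ 0 := by simp only [List.mem_cons, List.not_mem_nil, or_false] at h1; omega
  have h20 : z₂ ≠ 0 := by simp only [List.mem_cons, List.not_mem_nil, or_false] at h2; omega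
  have hS : ∀ s ∈ [0, z₁, z₂], s ∈ [0, 1, 2, 3, 4] := by
    intro s hs; simp only [List.mem_cons, List.not_mem_nil, or_false] at hs
    rcases hs with rfl | rfl | rfl
    · simp
    · exact List.mem_cons_of_mem _ h1
    · exact List.mem_cons_of_mem _ h2
  have hnd : [0, z₁, z₂].Nodup := by simp [h10.symm, h20.symm, h12]
  obtain ⟨c1, c2, c3⟩ := IsoPts.c3_conditions
  have key := iso_list_law w a v hv hinj hM [0, z₁, z₂] hS hnd (K := 2) (by norm_num) c1 c2 c3
  have hP1 : Pim z₁ z₂ (law w a v M) = lin (fun τ => DType.ind (τ.rho [0, z₁, z₂] z₁)) (law w a v M) :=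
    lin_congr (fun τ hτ => by rw [iso_typewise.1 τ hτ z₁ h1 z₂ h2 h12]) _
  have hP2 : Pim z₂ z₁ (law w a v M) = lin (fun τ => DType.ind (τ.rho [0, z₁, z₂] z₂)) (law w a v M) := by
    refine lin_congr (fun τ hτ => ?_) _
    rw [iso_typewise.1 τ hτ z₂ h2 z₁ h1 (Ne.symm h12)]
    simp only [DType.rho, List.all_cons, List.all_nil, Bool.and_true]
    cases τ.sep z₂ 0 <;> cases τ.sep z₂ z₁ <;> simp
  rw [hP1, hP2]
  simpa [Fin.prod_univ_three, mul_assoc] using key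

/-- **Relay ISO₃ rows** `u_{abc}^{c₃} ≤ M^{3−c₃}·∏ ρ`. [cite: VandenbergHaggstromKahn2005, Thm. 1.3 (p. 6)] -/
theorem isoR_law : ∀ z₁ ∈ [1, 2, 3, 4], ∀ z₂ ∈ [1, 2, 3, 4], ∀ z₃ ∈ [1, 2, 3, 4], z₁ ≠ z₂ → z₁ ≠ z₃ → z₂ ≠ z₃ →
    uS [z₁, z₂, z₃] (law w a v M) ^ ((3 + Real.sqrt 3) / 2) ≤
      M ^ (3 - (3 + Real.sqrt 3) / 2) * lin (fun τ => DType.ind (τ.rho [z₁, z₂, z₃] z₁)) (law w a v M) *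
        lin (fun τ => DType.ind (τ.rho [z₁, z₂, z₃] z₂)) (law w a v M) * lin (fun τ => DType.ind (τ.rho [z₁, z₂, z₃] z₃)) (law w a v M) := by
  intro z₁ h1 z₂ h2 z₃ h3 h12 h13 h23
  have hS : ∀ s ∈ [z₁, z₂, z₃], s ∈ [0, 1, 2, 3, 4] := by
    intro s hs; simp only [List.mem_cons, List.not_mem_nil, or_false] at hs
    rcases hs with rfl | rfl | rfl
    · exact List.mem_cons_of_mem _ h1
    · exact List.mem_cons_of_mem _ h2
    · exact List.mem_cons_of_mem _ h3
  have hnd : [z₁, z₂, z₃].Nodup := by simp [h12, h13, h23]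
  obtain ⟨c1, c2, c3⟩ := IsoPts.c3_conditions
  have key := iso_list_law w a v hv hinj hM [z₁, z₂, z₃] hS hnd (K := 2) (by norm_num) c1 c2 c3
  simpa [Fin.prod_univ_three, mul_assoc] using key

/-- **Hub ISO₄ rows** `u_{0abc}^{c₄} ≤ M^{4−c₄}·∏ ρ`. [cite: VandenbergHaggstromKahn2005, Thm. 1.3 (p. 6)] -/
theorem isoH4_law : ∀ z₁ ∈ [1, 2, 3, 4], ∀ z₂ ∈ [1, 2, 3, 4], ∀ z₃ ∈ [1, 2, 3, 4], z₁ ≠ z₂ → z₁ ≠ z₃ → z₂ ≠ z₃ →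
    uS [0, z₁, z₂, z₃] (law w a v M) ^ ((3 + Real.sqrt (11 / 3)) / 2) ≤
      M ^ (4 - (3 + Real.sqrt (11 / 3)) / 2) * lin (fun τ => DType.ind (τ.rho [0, z₁, z₂, z₃] 0)) (law w a v M) *
        lin (fun τ => DType.ind (τ.rho [0, z₁, z₂, z₃] z₁)) (law w a v M) *
        lin (fun τ => DType.ind (τ.rho [0, z₁, z₂, z₃] z₂)) (law w a v M) *
        lin (fun τ => DType.ind (τ.rho [0, z₁, z₂, z₃] z₃)) (law w a v M) := by
  intro z₁ h1 z₂ h2 z₃ h3 h12 h13 h23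
  have h10 : z₁ ≠ 0 := by simp only [List.mem_cons, List.not_mem_nil, or_false] at h1; omega
  have h20 : z₂ ≠ 0 := by simp only [List.mem_cons, List.not_mem_nil, or_false] at h2; omega
  have h30 : z₃ ≠ 0 := by simp only [List.mem_cons, List.not_mem_nil, or_false] at h3; omega
  have hS : ∀ s ∈ [0, z₁, z₂, z₃], s ∈ [0, 1, 2, 3, 4] := by
    intro s hs; simp only [List.mem_cons, List.not_mem_nil, or_false] at hs
    rcases hs with rfl | rfl | rfl | rfl
    · simp
    · exact List.mem_cons_of_mem _ h1
    · exact List.mem_cons_of_mem _ h2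
    · exact List.mem_cons_of_mem _ h3
  have hnd : [0, z₁, z₂, z₃].Nodup := by simp [h10.symm, h20.symm, h30.symm, h12, h13, h23]
  obtain ⟨c1, c2, c3⟩ := IsoPts.c4_conditions
  have key := iso_list_law w a v hv hinj hM [0, z₁, z₂, z₃] hS hnd (K := 3) (by norm_num) c1 c2 c3
  simpa [Fin.prod_univ_four, mul_assoc] using key

/-- **The ISO₄ row of the four relays** `u_{1234}^{c₄} ≤ M^{4−c₄}·∏_z (S_z + T_z)` (`ρ_z^{1234} = S_z ⊔ T_z`). [cite: VandenbergHaggstromKahn2005, Thm. 1.3 (p. 6)] -/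
theorem iso4_law : uS [1, 2, 3, 4] (law w a v M) ^ ((3 + Real.sqrt (11 / 3)) / 2) ≤
    M ^ (4 - (3 + Real.sqrt (11 / 3)) / 2) * (Sm 1 (law w a v M) + Tm 1 (law w a v M)) * (Sm 2 (law w a v M) + Tm 2 (law w a v M)) *
      (Sm 3 (law w a v M) + Tm 3 (law w a v M)) * (Sm 4 (law w a v M) + Tm 4 (law w a v M)) := by
  have hS : ∀ s ∈ [1, 2, 3, 4], s ∈ [0, 1, 2, 3, 4] := fun s hs => List.mem_cons_of_mem _ hs
  have hnd : [1, 2, 3, 4].Nodup := by decide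
  obtain ⟨c1, c2, c3⟩ := IsoPts.c4_conditions
  have key := iso_list_law w a v hv hinj hM [1, 2, 3, 4] hS hnd (K := 3) (by norm_num) c1 c2 c3
  -- `ρ_z^{1234}(law) = S_z(law) + T_z(law)`
  have hρ : ∀ z ∈ [1, 2, 3, 4], lin (fun τ => DType.ind (τ.rho [1, 2, 3, 4] z)) (law w a v M) = Sm z (law w a v M) + Tm z (law w a v M) := by
    intro z hz
    simp only [Sm, Tm, lin_ind_law w a v hv]
    rw [← add_div]
    congr 1
    have hdisj : Disjoint {ω : BondConfig (Fin n) | (typeOf a v ω).isS z = true} {ω | (typeOf a v ω).isT z = true} := by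
      rw [Set.disjoint_left]
      intro ω h1 h2
      have := (iso_typewise.2 _ (typeOf_mem a v hv ω) z hz).2
      simp only [mem_setOf_eq] at h1 h2
      rw [h1, h2] at this; simp at this
    rw [← measureReal_union hdisj MeasurableSet.of_discrete]
    congr 1; ext ω
    simp only [mem_setOf_eq, mem_union, (iso_typewise.2 _ (typeOf_mem a v hv ω) z hz).1, Bool.or_eq_true]
  rw [← hρ 1 (by simp), ← hρ 2 (by simp), ← hρ 3 (by simp), ← hρ 4 (by simp)]
  simpa [Fin.prod_univ_four, mul_assoc] using key

/-- **The ISO₅ row** `u_{01234}^{5/2} ≤ M^{5/2}·∏ ρ` (THEOREM E for the hub gadget). [cite: VandenbergHaggstromKahn2005, Thm. 1.3 (p. 6)] -/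
theorem iso5_law : uS [0, 1, 2, 3, 4] (law w a v M) ^ ((5 : ℝ) / 2) ≤
    M ^ ((5 : ℝ) / 2) * lin (fun τ => DType.ind (τ.rho [0, 1, 2, 3, 4] 0)) (law w a v M) *
      lin (fun τ => DType.ind (τ.rho [0, 1, 2, 3, 4] 1)) (law w a v M) * lin (fun τ => DType.ind (τ.rho [0, 1, 2, 3, 4] 2)) (law w a v M) *
      lin (fun τ => DType.ind (τ.rho [0, 1, 2, 3, 4] 3)) (law w a v M) * lin (fun τ => DType.ind (τ.rho [0, 1, 2, 3, 4] 4)) (law w a v M) := by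
  have hS : ∀ s ∈ [0, 1, 2, 3, 4], s ∈ [0, 1, 2, 3, 4] := fun s hs => hs
  have hnd : [0, 1, 2, 3, 4].Nodup := by decide
  have key := iso_list_law w a v hv hinj hM [0, 1, 2, 3, 4] hS hnd (K := 4) (γ := 5 / 2) (by norm_num) (by norm_num) (by norm_num)
    (by norm_num)
  have h52 : ((([0, 1, 2, 3, 4] : List ℕ).length : ℝ) - 5 / 2) = (5 : ℝ) / 2 := by norm_num
  rw [h52] at key
  simpa [Fin.prod_univ_five, mul_assoc] using key

end Instances

end Bridge
end TypeTable
end HubOnly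
end Summit.CriticalPhenomena.PercolationContinuityZ3.Theorems
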